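import Literature.Analysis.FluidPDE.OseenDuhamelRadialDecay
import HarnessLib

/-!
# Decay at spatial infinity of the Duhamel term, uniformly over bounded families of the
  non-decaying factor

Analysis/FluidPDE support file (everything proved; no definitions, no named facts), companion of
`OseenDuhamelRadialDecay.lean`: the same two decay statements with the quantifiers reordered so
that the threshold is chosen BEFORE the bounded (non-decaying) factor —
`∃ A, ∀ q (measurable, ‖q‖ ≤ Mq), ∀ t ∈ [s,T], ‖x‖ ≥ A → ‖B¹_s(p,q)(t)(x)‖ ≤ ε` — which is what the
proofs give (the threshold depends on the fields only through the bounds and the decay modulus of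
the decaying factor).  This is the form needed for UNIFORMLY small tails of the image of a ball
under the Duhamel part `W ↦ B(U, W) + B(W, U)` of a linearised Navier–Stokes flow at a decaying
background `U` (compactness in sup norm).

* `exists_forall_norm_oseenDuhamel_le_of_norm_left_uniform`,
* `exists_forall_norm_oseenDuhamel_le_of_norm_right_uniform`.

## References

* G. Koch, N. Nadirashvili, G. Seregin, V. Šverák, Acta Math. 203 (2009) = arXiv:0709.3599, §3
  (3.8) and proof of Thm. 6.1, last paragraph (arXiv pp. 6, 12). [KochNadirashviliSereginSverak2009]
-/

noncomputable section

open MeasureTheory Set Function Filter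
open _root_.Topology
open scoped ENNReal

namespace Literature.Analysis.FluidPDE

variable {E : Type*} [NormedAddCommGroup E] [InnerProductSpace ℝ E] [FiniteDimensional ℝ E]
  [MeasurableSpace E] [BorelSpace E]

/-- The dimension-dependent exponent `e = (d + 1)/2` of the kernel bound (3.8). -/
local notation "expo" E => ((Module.finrank ℝ E : ℝ) + 1) / 2

/-- **The Duhamel term of bounded fields, the LEFT one vanishing at spatial infinity uniformly in
time, vanishes at spatial infinity uniformly in time.**  For `p, q` jointly measurable on `ℝ × E`
and bounded by `Mp, Mq` on `(s, T) × E`, with `∀ η > 0, ∃ R, ∀ τ ∈ (s,T), ‖y‖ ≥ R → ‖p(τ,y)‖ ≤ η`,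
and every `ε > 0`, there is `A` such that `‖B¹_s(p,q)(t)(x)‖ ≤ ε` for all `t ∈ [s, T]` and all
`‖x‖ ≥ A`.  The threshold depends on the fields only through `Mp, Mq` and the decay modulus.
(KNSS 2009, proof of Thm. 6.1, last paragraph, qualitatively.) [cite: KochNadirashviliSereginSverak2009, proof of Thm 6.1, last paragraph (arXiv p. 12)] -/
theorem exists_forall_norm_oseenDuhamel_le_of_norm_left_uniform {p : ℝ → E → E} {s T Mp Mq : ℝ}
    (hpm : Measurable (uncurry p)) (hMp : 0 ≤ Mp) (hMq : 0 ≤ Mq)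
    (hp : ∀ τ ∈ Ioo s T, ∀ y, ‖p τ y‖ ≤ Mp)
    (hdec : ∀ η : ℝ, 0 < η → ∃ R : ℝ, ∀ τ ∈ Ioo s T, ∀ y, R ≤ ‖y‖ → ‖p τ y‖ ≤ η)
    {ε : ℝ} (hε : 0 < ε) :
    ∃ A : ℝ, ∀ q : ℝ → E → E, Measurable (uncurry q) → (∀ τ ∈ Ioo s T, ∀ y, ‖q τ y‖ ≤ Mq) →
      ∀ t ∈ Icc s T, ∀ x, A ≤ ‖x‖ → ‖oseenDuhamel 1 s p q t x‖ ≤ ε := by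
  obtain ⟨C, hC, hK⟩ := exists_norm_oseenKernel_le (E := E)
  have hC₀ := oseenSliceConst_pos (E := E)
  -- the far threshold: `C₀ η Mq 2√(T-s) ≤ ε/2`
  set Λ : ℝ := oseenSliceConst E * Mq * (2 * Real.sqrt (T - s)) with hΛ
  have hΛ0 : 0 ≤ Λ := by positivity
  set η : ℝ := ε / 2 / (Λ + 1) with hη
  have hη0 : 0 < η := by positivity
  have hΛη : Λ * η ≤ ε / 2 := by
    rw [hη]
    calc Λ * (ε / 2 / (Λ + 1)) = ε / 2 * (Λ / (Λ + 1)) := by ring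
      _ ≤ ε / 2 * 1 := by gcongr; rw [div_le_one (by positivity)]; linarith
      _ = ε / 2 := mul_one _
  obtain ⟨R₀, hR₀⟩ := hdec η hη0
  -- the near threshold: the kernel tail
  set H : E → ℝ := fun z => (2 : ℝ) ^ (expo E) * (1 + ‖z‖ ^ 2) ^ (-(expo E)) with hH
  have hHi : Integrable H volume :=
    (integrable_one_add_norm_sq_rpow_neg (E := E) (e := expo E) (by linarith)).const_mul _
  have htail := tendsto_setIntegral_norm_ge_atTop hHi
  -- if `T < s` the family of times is empty
  rcases lt_or_ge T s with hTs | hsT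
  · exact ⟨0, fun q _ _ t ht _ _ => absurd (ht.1.trans ht.2) (not_le.2 hTs)⟩
  have hTs0 : 0 ≤ T - s := sub_nonneg.2 hsT
  set θ : ℝ := ε / 2 / (C * (Mp * Mq) * (T - s) + 1) with hθ
  have hden : 0 < C * (Mp * Mq) * (T - s) + 1 := by positivity
  have hθ0 : 0 < θ := by positivity
  obtain ⟨R₁, hR₁⟩ :=
    ((htail.eventually (gt_mem_nhds hθ0)).and (eventually_ge_atTop 1)).exists_forall_of_atTop
  refine ⟨R₀ + R₁, fun q hqm hq t ht x hx => ?_⟩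
  rcases ht.1.eq_or_lt with h | hst
  · -- `t = s`: the Duhamel term vanishes
    rw [← h, oseenDuhamel_eq_zero_of_le le_rfl, norm_zero]; exact hε.le
  -- split the left field along `{R₀ ≤ ‖y‖}`
  set O : Set E := {y | R₀ ≤ ‖y‖} with hO
  have hOm : MeasurableSet O := (isClosed_le continuous_const continuous_norm).measurableSet
  set pf : ℝ → E → E := fun τ y => O.indicator (p τ) y with hpf
  set pn : ℝ → E → E := fun τ y => Oᶜ.indicator (p τ) y with hpn
  have hpfm : Measurable (uncurry pf) := by
    have : uncurry pf = ((univ : Set ℝ) ×ˢ O).indicator (uncurry p) := by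
      funext z; obtain ⟨τ, y⟩ := z
      simp only [uncurry, hpf, Set.indicator_apply, Set.mem_prod, Set.mem_univ, true_and]
    rw [this]; exact hpm.indicator (MeasurableSet.univ.prod hOm)
  have hpnm : Measurable (uncurry pn) := by
    have : uncurry pn = ((univ : Set ℝ) ×ˢ Oᶜ).indicator (uncurry p) := by
      funext z; obtain ⟨τ, y⟩ := z
      simp only [uncurry, hpn, Set.indicator_apply, Set.mem_prod, Set.mem_univ, true_and]
    rw [this]; exact hpm.indicator (MeasurableSet.univ.prod hOm.compl)
  have hsum : p = pf + pn := by
    funext τ y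
    simp only [hpf, hpn, Pi.add_apply]
    exact (Set.indicator_self_add_compl_apply O (p τ) y).symm
  have hpt : ∀ τ ∈ Ioo s t, τ ∈ Ioo s T := fun τ hτ => ⟨hτ.1, hτ.2.trans_le ht.2⟩
  have hbf : ∀ τ ∈ Ioo s t, ∀ y, ‖pf τ y‖ ≤ η := by
    intro τ hτ y
    simp only [hpf]
    by_cases hy : y ∈ O
    · rw [indicator_of_mem hy]; exact hR₀ τ (hpt τ hτ) y hy
    · rw [indicator_of_notMem hy, norm_zero]; exact hη0.le
  have hbn : ∀ τ ∈ Ioo s t, ∀ y, ‖pn τ y‖ ≤ Mp := by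
    intro τ hτ y
    simp only [hpn]
    by_cases hy : y ∈ Oᶜ
    · rw [indicator_of_mem hy]; exact hp τ (hpt τ hτ) y
    · rw [indicator_of_notMem hy, norm_zero]; exact hMp
  have hq' : ∀ τ ∈ Ioo s t, ∀ y, ‖q τ y‖ ≤ Mq := fun τ hτ y => hq τ (hpt τ hτ) y
  have hsplit : oseenDuhamel 1 s p q t x = oseenDuhamel 1 s pf q t x + oseenDuhamel 1 s pn q t x := by
    conv_lhs => rw [hsum]
    exact oseenDuhamel_window_add_left hpfm hpnm hqm hbf hbn hq' x
  -- the far part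
  have hfar : ‖oseenDuhamel 1 s pf q t x‖ ≤ ε / 2 := by
    have h := norm_oseenDuhamel_le_const hst.le hbf hq' x
    calc _ ≤ oseenSliceConst E * (η * Mq) * (2 * Real.sqrt (t - s)) := h
      _ ≤ oseenSliceConst E * (η * Mq) * (2 * Real.sqrt (T - s)) := by
          gcongr; exact ht.2
      _ = Λ * η := by rw [hΛ]; ring
      _ ≤ ε / 2 := hΛη
  -- the near part
  have hnear : ‖oseenDuhamel 1 s pn q t x‖ ≤ ε / 2 := by
    have hsupp : ∀ τ ∈ Ioo s t, ∀ y, R₀ ≤ ‖y‖ → ‖pn τ y‖ * ‖q τ y‖ = 0 := by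
      intro τ _ y hy
      have hyO : y ∉ Oᶜ := fun h => h hy
      simp only [hpn, indicator_of_notMem hyO, norm_zero, zero_mul]
    have h := norm_oseenDuhamel_near_le_of_norm hC hK hst hMp hMq hbn hq' hsupp (hR₁ R₁ le_rfl).2 hx
    have hT : ∫ z in {z : E | R₁ ≤ ‖z‖}, H z < θ := (hR₁ R₁ le_rfl).1
    have hc0 : 0 ≤ C * (Mp * Mq) * (t - s) := by have := sub_pos.2 hst; positivity
    have hts : C * (Mp * Mq) * (t - s) ≤ C * (Mp * Mq) * (T - s) := by gcongr; exact ht.2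
    calc _ ≤ C * (Mp * Mq) * (t - s) * ∫ z in {z : E | R₁ ≤ ‖z‖}, H z := h
      _ ≤ C * (Mp * Mq) * (t - s) * θ := mul_le_mul_of_nonneg_left hT.le hc0
      _ ≤ C * (Mp * Mq) * (T - s) * θ := mul_le_mul_of_nonneg_right hts hθ0.le
      _ = ε / 2 * (C * (Mp * Mq) * (T - s) / (C * (Mp * Mq) * (T - s) + 1)) := by rw [hθ]; ring
      _ ≤ ε / 2 * 1 := by
          gcongr
          rw [div_le_one hden]; linarith
      _ = ε / 2 := mul_one _
  rw [hsplit]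
  calc _ ≤ ‖oseenDuhamel 1 s pf q t x‖ + ‖oseenDuhamel 1 s pn q t x‖ := norm_add_le _ _
    _ ≤ ε / 2 + ε / 2 := add_le_add hfar hnear
    _ = ε := by ring

/-- **The Duhamel term of bounded fields, the RIGHT one vanishing at spatial infinity uniformly in
time, vanishes at spatial infinity uniformly in time** (twin of
`exists_forall_norm_oseenDuhamel_le_of_norm_left_uniform`, splitting the right slot; threshold
chosen before the left factor). [cite: KochNadirashviliSereginSverak2009, proof of Thm 6.1, last paragraph (arXiv p. 12)] -/
theorem exists_forall_norm_oseenDuhamel_le_of_norm_right_uniform {q : ℝ → E → E} {s T Mp Mq : ℝ}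
    (hqm : Measurable (uncurry q)) (hMp : 0 ≤ Mp) (hMq : 0 ≤ Mq)
    (hq : ∀ τ ∈ Ioo s T, ∀ y, ‖q τ y‖ ≤ Mq)
    (hdec : ∀ η : ℝ, 0 < η → ∃ R : ℝ, ∀ τ ∈ Ioo s T, ∀ y, R ≤ ‖y‖ → ‖q τ y‖ ≤ η)
    {ε : ℝ} (hε : 0 < ε) :
    ∃ A : ℝ, ∀ p : ℝ → E → E, Measurable (uncurry p) → (∀ τ ∈ Ioo s T, ∀ y, ‖p τ y‖ ≤ Mp) →
      ∀ t ∈ Icc s T, ∀ x, A ≤ ‖x‖ → ‖oseenDuhamel 1 s p q t x‖ ≤ ε := by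
  obtain ⟨C, hC, hK⟩ := exists_norm_oseenKernel_le (E := E)
  have hC₀ := oseenSliceConst_pos (E := E)
  set Λ : ℝ := oseenSliceConst E * Mp * (2 * Real.sqrt (T - s)) with hΛ
  have hΛ0 : 0 ≤ Λ := by positivity
  set η : ℝ := ε / 2 / (Λ + 1) with hη
  have hη0 : 0 < η := by positivity
  have hΛη : Λ * η ≤ ε / 2 := by
    rw [hη]
    calc Λ * (ε / 2 / (Λ + 1)) = ε / 2 * (Λ / (Λ + 1)) := by ring
      _ ≤ ε / 2 * 1 := by gcongr; rw [div_le_one (by positivity)]; linarith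
      _ = ε / 2 := mul_one _
  obtain ⟨R₀, hR₀⟩ := hdec η hη0
  set H : E → ℝ := fun z => (2 : ℝ) ^ (expo E) * (1 + ‖z‖ ^ 2) ^ (-(expo E)) with hH
  have hHi : Integrable H volume :=
    (integrable_one_add_norm_sq_rpow_neg (E := E) (e := expo E) (by linarith)).const_mul _
  have htail := tendsto_setIntegral_norm_ge_atTop hHi
  -- if `T < s` the family of times is empty
  rcases lt_or_ge T s with hTs | hsT
  · exact ⟨0, fun p _ _ t ht _ _ => absurd (ht.1.trans ht.2) (not_le.2 hTs)⟩
  have hTs0 : 0 ≤ T - s := sub_nonneg.2 hsT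
  set θ : ℝ := ε / 2 / (C * (Mp * Mq) * (T - s) + 1) with hθ
  have hden : 0 < C * (Mp * Mq) * (T - s) + 1 := by positivity
  have hθ0 : 0 < θ := by positivity
  obtain ⟨R₁, hR₁⟩ :=
    ((htail.eventually (gt_mem_nhds hθ0)).and (eventually_ge_atTop 1)).exists_forall_of_atTop
  refine ⟨R₀ + R₁, fun p hpm hp t ht x hx => ?_⟩
  rcases ht.1.eq_or_lt with h | hst
  · rw [← h, oseenDuhamel_eq_zero_of_le le_rfl, norm_zero]; exact hε.le
  set O : Set E := {y | R₀ ≤ ‖y‖} with hO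
  have hOm : MeasurableSet O := (isClosed_le continuous_const continuous_norm).measurableSet
  set qf : ℝ → E → E := fun τ y => O.indicator (q τ) y with hqf
  set qn : ℝ → E → E := fun τ y => Oᶜ.indicator (q τ) y with hqn
  have hqfm : Measurable (uncurry qf) := by
    have : uncurry qf = ((univ : Set ℝ) ×ˢ O).indicator (uncurry q) := by
      funext z; obtain ⟨τ, y⟩ := z
      simp only [uncurry, hqf, Set.indicator_apply, Set.mem_prod, Set.mem_univ, true_and]
    rw [this]; exact hqm.indicator (MeasurableSet.univ.prod hOm)
  have hqnm : Measurable (uncurry qn) := by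
    have : uncurry qn = ((univ : Set ℝ) ×ˢ Oᶜ).indicator (uncurry q) := by
      funext z; obtain ⟨τ, y⟩ := z
      simp only [uncurry, hqn, Set.indicator_apply, Set.mem_prod, Set.mem_univ, true_and]
    rw [this]; exact hqm.indicator (MeasurableSet.univ.prod hOm.compl)
  have hsum : q = qf + qn := by
    funext τ y
    simp only [hqf, hqn, Pi.add_apply]
    exact (Set.indicator_self_add_compl_apply O (q τ) y).symm
  have hpt : ∀ τ ∈ Ioo s t, τ ∈ Ioo s T := fun τ hτ => ⟨hτ.1, hτ.2.trans_le ht.2⟩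
  have hbf : ∀ τ ∈ Ioo s t, ∀ y, ‖qf τ y‖ ≤ η := by
    intro τ hτ y
    simp only [hqf]
    by_cases hy : y ∈ O
    · rw [indicator_of_mem hy]; exact hR₀ τ (hpt τ hτ) y hy
    · rw [indicator_of_notMem hy, norm_zero]; exact hη0.le
  have hbn : ∀ τ ∈ Ioo s t, ∀ y, ‖qn τ y‖ ≤ Mq := by
    intro τ hτ y
    simp only [hqn]
    by_cases hy : y ∈ Oᶜ
    · rw [indicator_of_mem hy]; exact hq τ (hpt τ hτ) y
    · rw [indicator_of_notMem hy, norm_zero]; exact hMq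
  have hp' : ∀ τ ∈ Ioo s t, ∀ y, ‖p τ y‖ ≤ Mp := fun τ hτ y => hp τ (hpt τ hτ) y
  have hsplit : oseenDuhamel 1 s p q t x = oseenDuhamel 1 s p qf t x + oseenDuhamel 1 s p qn t x := by
    conv_lhs => rw [hsum]
    exact oseenDuhamel_window_add_right hpm hqfm hqnm hp' hbf hbn x
  have hfar : ‖oseenDuhamel 1 s p qf t x‖ ≤ ε / 2 := by
    have h := norm_oseenDuhamel_le_const hst.le hp' hbf x
    calc _ ≤ oseenSliceConst E * (Mp * η) * (2 * Real.sqrt (t - s)) := h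
      _ ≤ oseenSliceConst E * (Mp * η) * (2 * Real.sqrt (T - s)) := by
          gcongr; exact ht.2
      _ = Λ * η := by rw [hΛ]; ring
      _ ≤ ε / 2 := hΛη
  have hnear : ‖oseenDuhamel 1 s p qn t x‖ ≤ ε / 2 := by
    have hsupp : ∀ τ ∈ Ioo s t, ∀ y, R₀ ≤ ‖y‖ → ‖p τ y‖ * ‖qn τ y‖ = 0 := by
      intro τ _ y hy
      have hyO : y ∉ Oᶜ := fun h => h hy
      simp only [hqn, indicator_of_notMem hyO, norm_zero, mul_zero]
    have h := norm_oseenDuhamel_near_le_of_norm hC hK hst hMp hMq hp' hbn hsupp (hR₁ R₁ le_rfl).2 hx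
    have hT : ∫ z in {z : E | R₁ ≤ ‖z‖}, H z < θ := (hR₁ R₁ le_rfl).1
    have hc0 : 0 ≤ C * (Mp * Mq) * (t - s) := by have := sub_pos.2 hst; positivity
    have hts : C * (Mp * Mq) * (t - s) ≤ C * (Mp * Mq) * (T - s) := by gcongr; exact ht.2
    calc _ ≤ C * (Mp * Mq) * (t - s) * ∫ z in {z : E | R₁ ≤ ‖z‖}, H z := h
      _ ≤ C * (Mp * Mq) * (t - s) * θ := mul_le_mul_of_nonneg_left hT.le hc0
      _ ≤ C * (Mp * Mq) * (T - s) * θ := mul_le_mul_of_nonneg_right hts hθ0.le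
      _ = ε / 2 * (C * (Mp * Mq) * (T - s) / (C * (Mp * Mq) * (T - s) + 1)) := by rw [hθ]; ring
      _ ≤ ε / 2 * 1 := by
          gcongr
          rw [div_le_one hden]; linarith
      _ = ε / 2 := mul_one _
  rw [hsplit]
  calc _ ≤ ‖oseenDuhamel 1 s p qf t x‖ + ‖oseenDuhamel 1 s p qn t x‖ := norm_add_le _ _
    _ ≤ ε / 2 + ε / 2 := add_le_add hfar hnear
    _ = ε := by ring

end Literature.Analysis.FluidPDE

end
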